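import Literature.AlgebraicGeometry.Resolution.DehomogenizationChartPrimes
import Literature.AlgebraicGeometry.Resolution.KawasakiChartStalk
import Literature.AlgebraicGeometry.Resolution.KawasakiChartValues
import Literature.AlgebraicGeometry.Resolution.AlterationsDimension
import Mathlib.AlgebraicGeometry.FunctionField
import HarnessLib

/-!
# The homogeneous prime of an integral closed subscheme of `ℙⁿ_k` and the dimension of its cone

Topic: `Literature/AlgebraicGeometry/Resolution` (input `P`, `D = dim X + 1` of the selection of
Kawasaki's forms, Kawasaki 2000, La. 5.3 / proof of Thm. 5.1, in the discharge of the named fact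
`KawasakiMacaulayfication`; Hartshorne II §5: the homogeneous ideal `I_Z = Γ_*(𝒥_Z)` of a closed
subscheme `Z ⊆ ℙⁿ`, Ex. II.5.10, and I §2 / I Ex. 2.6–2.10: the cone over a projective variety).

For an integral scheme `Z` with a morphism `ι : Z → ℙⁿ_k` (a closed immersion where stated) and a
standard chart `D₊(x_{j₀})` meeting `Z`:

* `projVanishingIdeal ι j₀ hj₀` — **the homogeneous ideal of `Z`**: the homogeneous core of the
  kernel of `ProjFrac.dehomFn ι j₀ hj₀ : k[x₀,…,xₙ] → K(Z)`, `G ↦ G(x/x_{j₀})`; a homogeneous PRIME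
  (`isPrime_projVanishingIdeal`);
* `mem_projVanishingIdeal_iff` — a form lies in it iff its dehomogenisation `ρ_j(G)` vanishes on the
  chart `Z_{x_j}`, for EVERY standard chart meeting `Z` (chart independence,
  `ProjFrac.fracFn_mk_eq_zero_iff`), so `map_dehomAway_projVanishingIdeal_eq`:
  `ρ_j(I_Z) B_j = ker (B_j ↠ Γ(Z, Z_{x_j}))`, and `X_not_mem_projVanishingIdeal`;
* `ringKrullDim_quotient_projVanishingIdeal` — **`dim k[x]/I_Z = dim Z + 1`** for `ι` a closed
  immersion and `Z` of finite type over `k`: on the chart `j₀`, `B_{j₀}/ρ_{j₀}(I_Z)B_{j₀} ≅ Γ(Z, Z_{x_{j₀}})`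
  has dimension `dim Z` (`topologicalKrullDim_eq_ringKrullDim_of_isAffineOpen`); the lower bound is
  the chain transport `ringKrullDim_quotient_add_one_le_of_map_dehomAway_le` and the upper bound the
  height transport `height_map_dehomAway_le` of `DehomogenizationChartPrimes.lean` together with the
  dimension formula in the affine domains `k[x]` and `B_{j₀} ≅ k[y]`.

One definition (`projVanishingIdeal`); everything else proved; no named facts.

## References

* R. Hartshorne, *Algebraic Geometry*, GTM 52 (1977): II Cor. 5.16, Ex. II.5.10, Ex. II.3.20;
  I §2 (proof of Prop. 2.2), Ex. I.2.6, Ex. I.2.10. [Hartshorne1977]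
* T. Kawasaki, *On Macaulayfication of Noetherian schemes*, Trans. AMS 352 (2000), §5. [Kawasaki2000]
-/

noncomputable section

open CategoryTheory AlgebraicGeometry TopologicalSpace HomogeneousLocalization MvPolynomial
open Literature.AlgebraicGeometry.Morphisms Literature.AlgebraicGeometry.Morphisms.ProjCech
open Literature.AlgebraicGeometry.Motives Literature.AlgebraicGeometry.Motives.ProjFrac
open Literature.AlgebraicGeometry.Motives.RatFn

universe u

attribute [local instance] MvPolynomial.gradedAlgebra
  Literature.AlgebraicGeometry.Motives.ProjBaseChange.algebraBase

namespace Literature.AlgebraicGeometry.Resolution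

variable {k : Type u} [Field k] {n : ℕ} {Z : Scheme.{u}} (ι : Z ⟶ PP k n) [IsIntegral Z]
  (j₀ : Fin (n + 1)) (hj₀ : genericPoint Z ∈ ZH ι (X j₀ : MvPolynomial (Fin (n + 1)) k))

/-- **The homogeneous ideal of an integral `Z → ℙⁿ_k`**: the homogeneous core (the ideal generated
by the FORMS it contains) of the kernel of `G ↦ G(x/x_{j₀}) ∈ K(Z)` (`ProjFrac.dehomFn`, for a chart
`D₊(x_{j₀})` meeting `Z`), i.e. the ideal generated by the forms `G` whose sections `G(s)` vanish on
`Z` (`mem_projVanishingIdeal_iff`: independent of `j₀`). For a closed immersion this is the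
saturated homogeneous ideal `I_Z` with `Γ(Z_{x_j}, 𝒪_Z) = (k[x]/I_Z)_{(x_j)}` (Hartshorne II 5.9/5.10,
Ex. II.5.10; the tree's `ProjFrac.exists_fracFn_eq_of_forall_isRegularAt`).
[cite: Hartshorne1977, II Cor. 5.16 and Ex. 5.10] -/
def projVanishingIdeal : Ideal (MvPolynomial (Fin (n + 1)) k) :=
  ((RingHom.ker (dehomFn ι j₀ hj₀)).homogeneousCore (grading k n)).toIdeal

/-- `I_Z` is a homogeneous ideal. [cite: Hartshorne1977, II Ex. 5.10 (a)] -/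
theorem isHomogeneous_projVanishingIdeal :
    (projVanishingIdeal ι j₀ hj₀).IsHomogeneous (grading k n) :=
  (Ideal.homogeneousCore (grading k n) _).isHomogeneous

/-- **`I_Z` is prime** for `Z` integral (the homogeneous core of the kernel of a homomorphism to the
function field). [cite: Hartshorne1977, II Ex. 5.10 and Ex. 3.12; I Ex. 2.4] -/
theorem isPrime_projVanishingIdeal : (projVanishingIdeal ι j₀ hj₀).IsPrime :=
  (RingHom.ker_isPrime (dehomFn ι j₀ hj₀)).homogeneousCore

/-- **A form lies in `I_Z` iff its dehomogenisation at `x_j` vanishes on the chart `Z_{x_j}`**, for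
ANY standard chart `D₊(x_j)` meeting `Z` (chart independence: `ProjFrac.fracFn_mk_eq_zero_iff`, and
`Γ(Z_{x_j}, 𝒪_Z) → K(Z)` is injective for `Z` integral).
[cite: Hartshorne1977, II Ex. 5.10; I §2, proof of Prop. 2.2] -/
theorem mem_projVanishingIdeal_iff {j : Fin (n + 1)}
    (hj : genericPoint Z ∈ ZH ι (X j : MvPolynomial (Fin (n + 1)) k)) {m : ℕ}
    {G : MvPolynomial (Fin (n + 1)) k} (hG : G ∈ grading k n m) :
    G ∈ projVanishingIdeal ι j₀ hj₀ ↔ evalAway ι (X j) (dehomAway k n j G) = 0 := by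
  have hGm : G ∈ grading k n (m • 1) := by simpa using hG
  rw [projVanishingIdeal]
  constructor
  · intro h
    have h' : G ∈ RingHom.ker (dehomFn ι j₀ hj₀) := Ideal.toIdeal_homogeneousCore_le _ _ h
    rw [RingHom.mem_ker, ← fracFn_mk_eq_zero_iff ι hj₀ (ProjectiveSpace.X_mem (R := k) j) one_pos
      hj m hGm, fracFn_apply] at h'
    rw [dehomAway_of_mem j hG]
    exact germ_injective_of_isIntegral Z (genericPoint Z) hj (h'.trans (map_zero _).symm)
  · intro h
    refine Ideal.mem_homogeneousCore_of_homogeneous_of_mem ⟨m, hG⟩ ?_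
    rw [RingHom.mem_ker, ← fracFn_mk_eq_zero_iff ι hj₀ (ProjectiveSpace.X_mem (R := k) j) one_pos
      hj m hGm, fracFn_apply, ← dehomAway_of_mem j hG, h]
    exact map_zero _

/-- **On every chart meeting `Z`, `I_Z` dehomogenises to the ideal of the chart**:
`ρ_j(I_Z) B_j = ker (B_j ↠ Γ(Z, Z_{x_j}))`. [cite: Hartshorne1977, II Ex. 5.10; I §2, proof of Prop. 2.2] -/
theorem map_dehomAway_projVanishingIdeal_eq {j : Fin (n + 1)}
    (hj : genericPoint Z ∈ ZH ι (X j : MvPolynomial (Fin (n + 1)) k)) :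
    (projVanishingIdeal ι j₀ hj₀).map (dehomAway k n j) = RingHom.ker (evalAway ι (X j)) := by
  classical
  refine le_antisymm ?_ fun b hb => ?_
  · rw [Ideal.map_le_iff_le_comap]
    intro G hG
    rw [Ideal.mem_comap, RingHom.mem_ker, ← DirectSum.sum_support_decompose (grading k n) G,
      map_sum, map_sum]
    refine Finset.sum_eq_zero fun i _ => ?_
    exact (mem_projVanishingIdeal_iff ι j₀ hj₀ hj (DirectSum.decompose (grading k n) G i).2).mp
      (isHomogeneous_projVanishingIdeal ι j₀ hj₀ i hG)
  · obtain ⟨m, G, hG, rfl⟩ := exists_eq_dehomAway j b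
    exact Ideal.mem_map_of_mem _ ((mem_projVanishingIdeal_iff ι j₀ hj₀ hj hG).mpr hb)

/-- `x_j ∉ I_Z` for a chart `D₊(x_j)` meeting `Z` (`ρ_j(x_j) = 1` and `Γ(Z, Z_{x_j}) ≠ 0`).
[cite: Hartshorne1977, II Ex. 5.10] -/
theorem X_not_mem_projVanishingIdeal {j : Fin (n + 1)}
    (hj : genericPoint Z ∈ ZH ι (X j : MvPolynomial (Fin (n + 1)) k)) :
    (X j : MvPolynomial (Fin (n + 1)) k) ∉ projVanishingIdeal ι j₀ hj₀ := by
  haveI : Nonempty (ZH ι (X j : MvPolynomial (Fin (n + 1)) k)) := ⟨⟨_, hj⟩⟩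
  intro h
  rw [mem_projVanishingIdeal_iff ι j₀ hj₀ hj (ProjectiveSpace.X_mem (R := k) j),
    dehomAway_of_mem j (ProjectiveSpace.X_mem (R := k) j)] at h
  have h1 : HomogeneousLocalization.Away.mk (grading k n) (ProjectiveSpace.X_mem (R := k) j) 1
      (X j : MvPolynomial (Fin (n + 1)) k) (by simpa using ProjectiveSpace.X_mem (R := k) j) = 1 := by
    apply HomogeneousLocalization.val_injective
    rw [HomogeneousLocalization.Away.val_mk, HomogeneousLocalization.val_one, Localization.mk_eq_mk',
      IsLocalization.mk'_eq_iff_eq_mul, one_mul]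
    simp
  rw [h1, map_one] at h
  exact one_ne_zero h

/-- `I_Z ≠ ⊤`. [cite: Hartshorne1977, II Ex. 5.10] -/
theorem projVanishingIdeal_ne_top : projVanishingIdeal ι j₀ hj₀ ≠ ⊤ :=
  (isPrime_projVanishingIdeal ι j₀ hj₀).ne_top

/-- **The cone over `Z` has dimension `dim Z + 1`**: `dim k[x₀,…,xₙ]/I_Z = dim Z + 1` for an integral
closed subscheme `Z ⊆ ℙⁿ_k` of finite type over `k`. Both inequalities come from the chart
`D₊(x_{j₀})`, where `ρ_{j₀}(I_Z) B_{j₀}` is the ideal of the affine piece `Z_{x_{j₀}}` (of dimension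
`dim Z`): chains above transport (`ringKrullDim_quotient_add_one_le_of_map_dehomAway_le`) and
heights do not increase (`height_map_dehomAway_le`; `k[x]` and `B_{j₀} ≅ k[y]` are catenary affine
domains). [cite: Hartshorne1977, I Ex. 2.6 and Ex. 2.10; II Ex. 3.20] -/
theorem ringKrullDim_quotient_projVanishingIdeal [IsClosedImmersion ι]
    (f : Z ⟶ Spec (.of k)) [LocallyOfFiniteType f] {d : ℕ} (hd : topologicalKrullDim Z = d) :
    ringKrullDim (MvPolynomial (Fin (n + 1)) k ⧸ projVanishingIdeal ι j₀ hj₀) = (d + 1 : ℕ) := by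
  haveI := isPrime_projVanishingIdeal ι j₀ hj₀
  haveI : Algebra.FiniteType k (Away (grading k n) (X j₀ : MvPolynomial (Fin (n + 1)) k)) :=
    (inferInstance : Algebra.FiniteType k (MvPolynomial (Fin n) k)).equiv
      (ProjectiveSpace.chartAlgEquiv k j₀).symm
  set P := projVanishingIdeal ι j₀ hj₀ with hPdef
  set K : Ideal (Away (grading k n) (X j₀ : MvPolynomial (Fin (n + 1)) k)) :=
    RingHom.ker (evalAway ι (X j₀)) with hKdef
  have hPK : P.map (dehomAway k n j₀) = K := map_dehomAway_projVanishingIdeal_eq ι j₀ hj₀ hj₀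
  haveI hKprime : K.IsPrime := by
    rw [← hPK]
    exact isPrime_map_dehomAway j₀ (isHomogeneous_projVanishingIdeal ι j₀ hj₀)
      (X_not_mem_projVanishingIdeal ι j₀ hj₀ hj₀)
  -- `dim B/K = dim Γ(Z, Z_{x_{j₀}}) = dim Z = d`
  have hBK : ringKrullDim (Away (grading k n) (X j₀ : MvPolynomial (Fin (n + 1)) k) ⧸ K) = d := by
    rw [hKdef, ringKrullDim_eq_of_ringEquiv (RingHom.quotientKerEquivOfSurjective
      (evalAway_surjective ι (Segre.X_mem k j₀) one_pos)), ← hd]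
    exact (topologicalKrullDim_eq_ringKrullDim_of_isAffineOpen f (isAffineOpen_ZH_X ι j₀)
      ⟨_, hj₀⟩).symm
  -- lower bound: chains above transport
  have hlow : ((d + 1 : ℕ) : WithBot ℕ∞) ≤ ringKrullDim (MvPolynomial (Fin (n + 1)) k ⧸ P) := by
    have h := ringKrullDim_quotient_add_one_le_of_map_dehomAway_le j₀
      (isHomogeneous_projVanishingIdeal ι j₀ hj₀) hPK.le
    rw [hBK] at h
    exact_mod_cast h
  -- upper bound: heights
  obtain ⟨e, he, -⟩ :=
    Literature.RingTheory.KrullDimension.exists_ringKrullDim_eq_and_trdeg_eq k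
      (MvPolynomial (Fin (n + 1)) k ⧸ P)
  obtain ⟨hP, hhP⟩ := exists_height_eq k P
  have hsumP := height_add_eq_of_ringKrullDim_quotient k (ringKrullDim_mvPolynomial_fin_eq k (n + 1))
    P he hhP
  obtain ⟨hK, hhK⟩ := exists_height_eq k K
  have hsumK := height_add_eq_of_ringKrullDim_quotient k (ringKrullDim_away_X (k := k) j₀) K hBK hhK
  have hKP : K.height ≤ P.height := by
    rw [← hPK]
    exact height_map_dehomAway_le j₀ (isHomogeneous_projVanishingIdeal ι j₀ hj₀)
      (X_not_mem_projVanishingIdeal ι j₀ hj₀ hj₀)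
  rw [hhK, hhP] at hKP
  have hKP' : hK ≤ hP := by exact_mod_cast hKP
  have hup : e ≤ d + 1 := by omega
  rw [he] at hlow ⊢
  have hlow' : d + 1 ≤ e := by exact_mod_cast hlow
  exact_mod_cast le_antisymm hup hlow'

end Literature.AlgebraicGeometry.Resolution

end
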